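import Summits.BirchSwinnertonDyer.BirchSwinnertonDyer.Theorems.CumulativeHeegnerLeopoldtEisensteinCharacterInvariantsAtThreeStubCurveRelaxationCorankEq
import Summits.BirchSwinnertonDyer.BirchSwinnertonDyer.Theorems.EisensteinPrimesAcTwistDeformationCurveSUROfSurC
import Summits.BirchSwinnertonDyer.BirchSwinnertonDyer.Theorems.SchneiderFreeAdditiveX3SurLambdaCaseCTCHolds
import Literature.NumberTheory.IwasawaTheory.Greenberg2006.GlobalEulerPoincareCorankOfTateTC
import Literature.NumberTheory.GaloisCohomology.TateGlobalEulerCharacteristicTotallyComplex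
import Literature.NumberTheory.GaloisCohomology.RestrictedRamificationPoitouTateThreeLeTotallyComplex
import HarnessLib

/-!
# Route `CumulativeHeegnerLeopoldt`, crux K2-odd `EisensteinCharacterInvariantsAtThreeOdd` (stmt-BirchSwinnertonDyer-23970), line `birth`
# v11: the curve-side RELAXATION COUNT (former stub ALG-≥(i) `stub_curveRelaxationCorankEq`, p707562) RE-KEYED OFF GREENBERG —
# `corank_{ℤ_3}(Sel_{𝔭′}^{Sf′}/Sel_{𝔭′}^∅)(E_K) = Σ_{w∈Sf′} [Γ:Γ_w] · corank_{ℤ_3} H¹(K_{∞,w}, E[3^∞])` on the Leopoldt cell GRANTED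
# CGLS 2022 Prop. 14 ONLY (helper, `--supports stmt-BirchSwinnertonDyer-23970`)

Prover `leafhand-bsd-cumulativeheegnerl-1` g0 (cell `bsd-eis`, route `CumulativeHeegnerLeopoldt`). The tree theorem
`EisensteinCharacterInvariantsAtThreeCurveRelaxation.stub_curveRelaxationCorankEq` (p707562, lead `bsd-line-chl-p1` g10) proves the
registered stub ALG-≥(i) of line `birth` v8 GRANTED four named facts: CGLS 2022 Prop. 14, Greenberg 2016 Prop. 2.6.3
(`prop263_sur_of_crk`), Greenberg 2006 Props. 4.1 (`prop41_globalEulerPoincareCorank`) and 3.2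
(`prop32_cohomology_isCofinitelyGenerated`). The three Greenberg facts enter ONLY through cell `bsd-eis`'s curve SUR engine
`AcTwistDeformation.primaryTorsion_fullAt_SUR` (in `CurveRelaxationLocSurj.curve_exists_forall_resOfLe_conjH1_pow_eq_tame`), and
every one of them is consumed there in a form that is by now a TREE THEOREM:

* Greenberg 2016 Prop. 2.6.3 is used in case (c) at the imaginary quadratic — hence totally complex — field `K`: cell `bsd-eis`'s
  v30 re-typing `AcTwistDeformation.primaryTorsion_fullAt_SUR_ofSurC` takes `prop263_sur_of_crk_caseC_tc` instead, and that named fact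
  HOLDS (`SurLambda.prop263_sur_of_crk_caseC_tc_holds`: road «SUR-Λ» + lane «PT-Ш-S-TC», Milne ADT I Thm. 4.10 (a) at finite `S`
  over totally complex fields, 2026-08-29);
* Greenberg 2006 Prop. 4.1 (typed for totally imaginary `K`) is `prop41_of_tate_of_poitouTate_three_le_of_isTotallyComplex` fed with
  the tree theorems `forall_tateGlobalEulerPoincareCharacteristic_of_isTotallyComplex` (Milne ADT I Thm. 5.1) and
  `forall_poitouTate_restricted_three_le_of_isTotallyComplex` (Harari Thm. 17.13 (a));
* Greenberg 2006 Prop. 3.2 is read by the `…OfSurC` engine in degrees `≤ 2` at totally complex fields through Tate's global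
  Euler–Poincaré characteristic (`forall_tateGlobalEulerPoincareCharacteristic_of_isTotallyComplex`);
* Greenberg 2006 Prop. 4.2 and §5 A were already fed as the tree theorems `prop42_localEulerPoincareCorank_holds`,
  `sec5A_localH2_subsingleton_of_LOC1_holds` (p707562).

RESULTS (proofs token-identical to the tree proofs of p707562 / `…CurveRelaxationLocSurj`, with the one engine call re-keyed):
* §1 `curve_exists_forall_resOfLe_conjH1_pow_eq_tame_ofTree` — the `K_∞`-side global-to-local surjectivity for `E[p^∞]` at the
  tame bad places, `∃`-form, with NO named-fact hypothesis (any odd `p`, `K` imaginary quadratic under (Heeg), `X_ac^∅` f.g. torsion);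
* §2 `stub_curveRelaxationCorankEq_ofPrint` — the registered signature of stub ALG-≥(i) with its LAST THREE fact antecedents
  removed: `prop14_residualCharacterSelmer_finite → (the count on the Leopoldt cell)` (the registered four-antecedent shape is the
  landed p707562 itself; Greenberg 2006 Prop. 4.1 enters as the three-token composition of
  `KYBranchGreenbergDischarged.greenberg2006_prop41_ofTree`, inlined to keep the imports inside cell `bsd-eis` / Literature).

CONSEQUENCE for the line: after this file the curve-side half [ALG-≥] of the λ-formula rests on CGLS Prop. 14 alone (the local
lower bound ALG-≥(ii) is the unconditional tree theorem p708936); the Greenberg 2016 / 2006 conjuncts of the registered PRINT stub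
`stub_algLambdaPrintedFacts` are no longer consumed by [ALG-≥] (the door half is re-keyed in the sister file
`…EisensteinCharacterInvariantsAtThreeAlgLambdaDoorOfCGLS`).

HONEST FRAMING: compositions of tree theorems; §2 is CONDITIONAL BY NAME on ONE published fact (CGLS 2022 Prop. 14, typed as a
`Prop`, not proved in the tree); no definition, no named fact introduced, no `sorry`; closes no stub by itself (the registered stub
ALG-≥(i) was already a theorem; this file only shrinks its inputs). BSD is not proved for any curve by any of this.
References: [PollackWeston2011] App. A Prop. A.2; [GreenbergVatsal2000] §2 Cor. (2.3), Prop. (2.4); [CastellaGrossiLeeSkinner2022] §1.4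
(eq:1), Prop. 14; [Greenberg2016Selmer] Prop. 2.6.3 (c); [Greenberg2010] Prop. 3.2.1 (c); [Greenberg2006] Props. 3.2, 4.1, 4.2, §5 A;
[MilneADT2006] I Thms. 4.10 (a), 5.1; [Harari2020] Thm. 17.13 (a); [Brink2007] Thm. 2; tree p707562, `…CurveRelaxationLocSurj`,
`…AcTwistDeformationCurveSUROfSurC`, `…SurLambdaCaseCTCHolds`.
-/

set_option autoImplicit false
-- `…BirchSwinnertonDyer.BirchSwinnertonDyer.Theorems…` is the problem's mandated namespace (D-0017).
set_option linter.dupNamespace false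

noncomputable section

open scoped Classical
open NumberField IsDedekindDomain Field Multiplicative PowerSeries WeierstrassCurve
open Literature.NumberTheory.EllipticCurves Literature.NumberTheory.EllipticCurves.GreenbergSelmer
  Literature.NumberTheory.EllipticCurves.GreenbergVatsal2000 Literature.NumberTheory.GaloisRepresentations
  Literature.NumberTheory.GaloisCohomology
  Literature.NumberTheory.EllipticCurves.KellerYin2024 Literature.NumberTheory.EllipticCurves.IwasawaDual
  Literature.NumberTheory.EllipticCurves.Castella2018.AcSelmer
  Literature.NumberTheory.EllipticCurves.Rank1Residual
  Literature.NumberTheory.IwasawaTheory Literature.NumberTheory.IwasawaTheory.Greenberg2016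
  Literature.NumberTheory.IwasawaTheory.Greenberg2006
  Summit.BirchSwinnertonDyer.BirchSwinnertonDyer.Theorems
  Summit.BirchSwinnertonDyer.BirchSwinnertonDyer.Theorems.GreenbergFullAtSelmer
  Summit.BirchSwinnertonDyer.BirchSwinnertonDyer.Theorems.AcTwistDeformationResidualPair
  Summit.BirchSwinnertonDyer.BirchSwinnertonDyer.Theorems.AcTwistDeformation

namespace Summit.BirchSwinnertonDyer.BirchSwinnertonDyer.Theorems.EisensteinCharacterInvariantsAtThreeCurveRelaxationOfTree

/-! ### §1 The `K_∞`-side surjectivity at the tame bad places, no named-fact hypothesis -/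

section LocSurj

variable {K : Type} [Field K] [NumberField K] {p : ℕ} [Fact p.Prime]

/-- **The `K_∞`-side global-to-local surjectivity for `E[p^∞]` at the tame bad places, `∃`-form, with NO named-fact hypothesis.**
For `W/ℚ` elliptic, `p` odd, `K` imaginary quadratic with (Heeg) for `N_W`, `(p) = v v̄` in `K`, `κ` the anticyclotomic `ℤ_p`-extension with
topological generator `γ`, `Sf` = the places of `K` over `N_W` prime to `p`, and `X_ac^∅(v̄)` finitely generated `Λ`-torsion: there are
exponents `a_w` (`κ(D_w) = p^{a_w}ℤ_p` exactly, `w ∈ Sf`) such that every family of local classes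
`y w i ∈ H¹(ker κ ⊓ D_w, E[p^∞])` (`w ∈ Sf`, `i < p^{a_w}`) is realised by ONE class `u ∈ Sel_{v̄}^{Sf}(K_∞, E[p^∞])`:
`res_{ker κ ⊓ D_w}(conj_{γ^i} u) = y w i`. Proof = the tree proof of `CurveRelaxationLocSurj.curve_exists_forall_resOfLe_conjH1_pow_eq_tame`
with SUR(`𝐃_E`, `𝓛_v`) taken from the `…OfSurC` engine fed by tree theorems (Greenberg 2016 Prop. 2.6.3 (c) at totally complex `K`,
Greenberg 2006 Props. 4.1, 4.2, §5 A, Tate's global Euler–Poincaré characteristic).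
[cite: Greenberg2016Selmer, Prop. 2.6.3 (c) (§2.6 p. 10), §4.3 pp. 20–21] [cite: Greenberg2010, Prop. 3.2.1 (c) (p. 15)]
[cite: Greenberg2006, Thm. 3 p. 342, Props. 3.2, 4.1, 4.2, §5 A] [cite: MilneADT2006, I Thms. 4.10 (a), 5.1]
[cite: PollackWeston2011, App. A Prop. A.2] [cite: CastellaGrossiLeeSkinner2022, §1.4 (eq:1)] [cite: Castella2018, Def. 2.2] -/
theorem curve_exists_forall_resOfLe_conjH1_pow_eq_tame_ofTree
    (W : WeierstrassCurve ℚ) [W.IsElliptic] (hp : 2 < p) (hK : IsImaginaryQuadratic K)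
    (hH : SatisfiesHeegnerHypothesis (W.conductorNorm ℤ) K)
    {v vbar : HeightOneSpectrum (𝓞 K)} (hv : ((p : ℕ) : 𝓞 K) ∈ v.asIdeal)
    (hvbar : ((p : ℕ) : 𝓞 K) ∈ vbar.asIdeal) (hne : vbar ≠ v)
    (κ : ZpExtension K p) (hκ : κ.IsAnticyclotomic) (γ : absoluteGaloisGroup K)
    [hγ : Fact (κ.IsTopGenerator γ)]
    (Sf : Finset (HeightOneSpectrum (𝓞 K)))
    (hSf : ∀ w : HeightOneSpectrum (𝓞 K), w ∈ Sf ↔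
      (((W.conductorNorm ℤ : ℤ) : 𝓞 K) ∈ w.asIdeal ∧ ((p : ℕ) : 𝓞 K) ∉ w.asIdeal))
    (hXfin : Module.Finite (IwasawaAlgebra p)
      (XAc (W.baseChange K) p κ vbar (∅ : Set (HeightOneSpectrum (𝓞 K))) γ))
    (hXtor : Module.IsTorsion (IwasawaAlgebra p)
      (XAc (W.baseChange K) p κ vbar (∅ : Set (HeightOneSpectrum (𝓞 K))) γ)) :
    ∃ a : HeightOneSpectrum (𝓞 K) → ℕ,
      (∀ w ∈ Sf, ∀ δ ∈ decomp (K := K) w, (p : ℤ_[p]) ^ a w ∣ (κ δ).toAdd) ∧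
      (∀ w ∈ Sf, ∃ δ ∈ decomp (K := K) w, (κ δ).toAdd = (p : ℤ_[p]) ^ a w) ∧
      ∀ y : (w : HeightOneSpectrum (𝓞 K)) → ℕ →
          subgroupH1 (κ.kerSubgroup ⊓ decomp (K := K) w) ((W.baseChange K).geomPrimaryTorsion p),
        ∃ u ∈ Summit.BirchSwinnertonDyer.Rank1Residual.X11b.AcSelmer.selmerAc (W.baseChange K) p κ vbar
            (↑Sf : Set (HeightOneSpectrum (𝓞 K))),
          ∀ w ∈ Sf, ∀ i : ℕ, i < p ^ a w →
            resOfLe ((W.baseChange K).geomPrimaryTorsion p)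
              (inf_le_left : κ.kerSubgroup ⊓ decomp (K := K) w ≤ κ.kerSubgroup)
              (conjH1 κ.kerSubgroup ((W.baseChange K).geomPrimaryTorsion p) (γ ^ i) u) = y w i := by
  haveI hEK : (W.baseChange K).IsElliptic := inferInstanceAs (W.map (algebraMap ℚ K)).IsElliptic
  -- the places of `Sf` are finitely decomposed: `κ(D_w) = p^{a_w} ℤ_p` exactly
  have hdec : ∀ w ∈ Sf, ¬ decomp (K := K) w ≤ κ.kerSubgroup := fun w hw hle ↦ by
    obtain ⟨σ, hσ⟩ := exists_local_apply_ne_one_of_mem_or hK hp hH κ hκ w (Or.inr ((hSf w).mp hw).1)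
    exact hσ (ZpExtension.mem_kerSubgroup.mp (hle ((mem_decomp_iff w _).mpr ⟨σ, rfl⟩)))
  have hex : ∀ w : HeightOneSpectrum (𝓞 K), ∃ c : ℕ, w ∈ Sf →
      (∃ δ ∈ decomp (K := K) w, (κ δ).toAdd = (p : ℤ_[p]) ^ c) ∧
      (∀ δ ∈ decomp (K := K) w, (p : ℤ_[p]) ^ c ∣ (κ δ).toAdd) := by
    intro w
    by_cases hw : w ∈ Sf
    · obtain ⟨c, ⟨d₀, hd₀⟩, -, hdvd⟩ :=
        UniversalToricDescentSigmaLocalStabilizer.exists_pow_and_forall_dvd_of_not_le κ w (hdec w hw)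
      exact ⟨c, fun _ ↦ ⟨⟨d₀, d₀.2, hd₀⟩, fun δ hδ ↦ hdvd ⟨δ, hδ⟩⟩⟩
    · exact ⟨0, fun h ↦ absurd h hw⟩
  choose a ha using hex
  refine ⟨a, fun w hw ↦ (ha w hw).2, fun w hw ↦ (ha w hw).1, fun y ↦ ?_⟩
  -- `S = {v, v̄} ∪ Sf` contains the places above `p` and the bad places of `E_K`
  set S : Set (HeightOneSpectrum (𝓞 K)) := (↑(insert v (insert vbar Sf)) : Set (HeightOneSpectrum (𝓞 K)))
    with hSdef
  have hS : ∀ w : HeightOneSpectrum (𝓞 K), ((p : ℕ) : 𝓞 K) ∈ w.asIdeal → w ∈ S :=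
    mem_insert_insert_of_natCast_mem hK hv hvbar hne Sf
  have hSfS : ∀ w ∈ Sf, w ∈ S := fun w hw ↦ by
    rw [hSdef, Finset.coe_insert, Finset.coe_insert]
    exact Or.inr (Or.inr (Finset.mem_coe.mpr hw))
  have hgoodN : ∀ w : HeightOneSpectrum (𝓞 K), w ∉ Sf → ((p : ℕ) : 𝓞 K) ∉ w.asIdeal →
      (W.baseChange K).HasGoodReductionAt w := fun w hw hpw ↦
    EisensteinPrimesMuLambda.hasGoodReductionAt_baseChange_of_conductorNorm_notMem W w fun h ↦ hw ((hSf w).mpr ⟨h, hpw⟩)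
  have hSbad : ∀ w : HeightOneSpectrum (𝓞 K), ¬ (W.baseChange K).HasGoodReductionAt w → w ∈ S := by
    intro w hw
    by_cases hpw : ((p : ℕ) : 𝓞 K) ∈ w.asIdeal
    · exact hS w hpw
    · exact hSfS w (by_contra fun hw' ↦ hw (hgoodN w hw' hpw))
  have hgood : ∀ w : HeightOneSpectrum (𝓞 K), w ∉ S → ((p : ℕ) : 𝓞 K) ∉ w.asIdeal →
      (W.baseChange K).HasGoodReductionAt w := fun w hw hpw ↦ hgoodN w (fun h ↦ hw (hSfS w h)) hpw
  -- the model `ρ₀` of `E_K[p^∞]` over `G_{K,S}` (Néron–Ogg–Shafarevich)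
  have hNS : ∀ n ∈ ramificationSubgroup K S, ∀ P : PrimaryTorsion (W.baseChange K).geomPoints p, n • P = P :=
    fun n hn P ↦ SignedBaseChangeAcDivCurveModel.smul_primaryTorsion_eq_of_mem_ramificationSubgroup
      (W.baseChange K) p S hSbad hS hn P
  obtain ⟨ρ₀, hρ₀⟩ := SignedBaseChangeAcDivCurveModel.exists_continuousRep_primaryTorsion (W.baseChange K) p S hNS
  -- the canonical (discrete) topological instances of the arena
  letI tΛ : TopologicalSpace (PowerSeries ℤ_[p]) := ⊥
  haveI : DiscreteTopology (PowerSeries ℤ_[p]) := ⟨rfl⟩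
  haveI : IsTopologicalRing (PowerSeries ℤ_[p]) := inferInstance
  haveI : IsTopologicalAddGroup (BigRepModule ℤ_[p] p (PrimaryTorsion (W.baseChange K).geomPoints p)) :=
    inferInstance
  haveI : ContinuousSMul (PowerSeries ℤ_[p]) (BigRepModule ℤ_[p] p (PrimaryTorsion (W.baseChange K).geomPoints p)) :=
    inferInstance
  -- `K` imaginary quadratic
  haveI := hK.2
  have hKc : ∀ w : InfinitePlace K, w.IsComplex := IsTotallyComplex.isComplex
  -- `corank_Λ S_{𝓛_v}(K, 𝐃_E) = 0` from the cotorsion of `X_ac^∅`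
  obtain ⟨hSel, -⟩ := hasCorank_fullAtSelmer_zero_of_xAc S (W.baseChange K) hS κ ρ₀ hρ₀ hKc hv hvbar hne
    hgood hXfin hXtor
  -- SUR(`𝐃_E`, `𝓛_v`): the `σ`-supply on `S` by class field theory above `p` and Brink at the split `Sf`
  have hsup : ∀ w : HeightOneSpectrum (𝓞 K), w ∈ S →
      ∃ σ : absoluteGaloisGroup (Place.Completion (Sum.inr w : Place K)), κ (absGaloisRestrict K _ σ) ≠ 1 := by
    intro w hw
    rw [hSdef, Finset.coe_insert, Finset.coe_insert] at hw
    rcases hw with rfl | rfl | hw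
    · exact exists_local_apply_ne_one_of_mem_or hK hp hH κ hκ _ (Or.inl hv)
    · exact exists_local_apply_ne_one_of_mem_or hK hp hH κ hκ _ (Or.inl hvbar)
    · exact exists_local_apply_ne_one_of_mem_or hK hp hH κ hκ w (Or.inr ((hSf w).mp (Finset.mem_coe.mp hw)).1)
  -- the ONE re-keyed call: the `…OfSurC` SUR engine, all five of its fact hypotheses fed by TREE THEOREMS
  have hSUR := primaryTorsion_fullAt_SUR_ofSurC (W.baseChange K) hS κ ρ₀ SurLambda.prop263_sur_of_crk_caseC_tc_holds
    (prop41_of_tate_of_poitouTate_three_le_of_isTotallyComplex forall_tateGlobalEulerPoincareCharacteristic_of_isTotallyComplex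
      forall_poitouTate_restricted_three_le_of_isTotallyComplex)
    LocalEulerPoincareCorank.prop42_localEulerPoincareCorank_holds sec5A_localH2_subsingleton_of_LOC1_holds
    forall_tateGlobalEulerPoincareCharacteristic_of_isTotallyComplex (Finset.finite_toSet _) hK hsup hne hv hvbar hSel
  -- the Shapiro descent with `ψ = id`
  let ψ : PrimaryTorsion (W.baseChange K).geomPoints p ≃+ (W.baseChange K).geomPrimaryTorsion p :=
    AddEquiv.refl _
  have hψ : ∀ (σ : absoluteGaloisGroup K) (x : PrimaryTorsion (W.baseChange K).geomPoints p),
      ψ (ρ₀ (toUnramifiedQuot K S σ) x) = σ • ψ x := fun σ x ↦ by rw [hρ₀]; rfl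
  have hA : ∀ x : PrimaryTorsion (W.baseChange K).geomPoints p, ∃ k : ℕ, p ^ k • x = 0 := fun x ↦ by
    obtain ⟨k, hk⟩ := x.exists_pow_smul_eq_zero
    exact ⟨k, PrimaryTorsion.ext (by rw [PrimaryTorsion.val_nsmul]; exact hk)⟩
  obtain ⟨F, hF⟩ := exists_shapiroDescent S hS κ ρ₀ ψ hψ
  -- representatives `γ^i`
  have hσrep : ∀ w ∈ Sf, ∀ i : ℕ, i < p ^ a w →
      (κ ((fun (_ : HeightOneSpectrum (𝓞 K)) (i : ℕ) ↦ γ ^ i) w i)).toAdd = (i : ℤ_[p]) := fun w _ i _ ↦ by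
    change (κ (γ ^ i)).toAdd = (i : ℤ_[p])
    rw [map_pow, show κ γ = Multiplicative.ofAdd 1 from hγ.out, ← ofAdd_nsmul, toAdd_ofAdd, nsmul_one]
  have hSfv : ∀ w ∈ Sf, w ≠ v := fun w hw h ↦ ((hSf w).mp hw).2 (h ▸ hv)
  obtain ⟨u, hunr, haway, hev⟩ := exists_mem_unramifiedOutside_forall_resOfLe_conjH1_eq_of_SUR S hS κ ρ₀ ψ hψ
    hv hSUR hA hF Sf hSfS hSfv a (fun w hw ↦ (ha w hw).2) (fun w hw ↦ (ha w hw).1) (fun _ i ↦ γ ^ i) hσrep y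
  refine ⟨u, ?_, fun w hw i hi ↦ hev w hw i hi⟩
  -- `u ∈ Sel_v̄^{Sf}`: unramified outside `Sf`, strict (= locally trivial) at `v̄`, no condition at `v`
  have hmem : u ∈ datumStrictSelmer κ.kerSubgroup ((W.baseChange K).geomPrimaryTorsion p) p
      (bdpData ((W.baseChange K).geomPrimaryTorsion p) p vbar) (↑Sf : Set (HeightOneSpectrum (𝓞 K))) := by
    refine (mem_datumStrictSelmer_iff u).2 ⟨hunr, fun w hw σ ↦ ?_⟩
    by_cases hwv : w = vbar
    · subst hwv
      rw [bdpData_self p w hw, BigGaloisRep.strictKer_strictDatum_eq_awayKer]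
      exact haway w (hS w hw) hne (fun h ↦ ((hSf w).mp h).2 hw) σ
    · rw [bdpData_of_ne p vbar hw hwv, strictKer_relaxedDatum_eq_top]
      exact AddSubgroup.mem_top _
  exact IndexPlumbingDictionary.datumStrictSelmer_le_selmerAc (W.baseChange K) p κ vbar
    (↑Sf : Set (HeightOneSpectrum (𝓞 K))) hKc hvbar
    (fun w hw hpw ↦ hgoodN w (fun h ↦ hw (Finset.mem_coe.mpr h)) hpw) hmem

end LocSurj

/-! ### §2 The relaxation count on the Leopoldt cell, GRANTED CGLS Prop. 14 ONLY -/

/-- **Stub ALG-≥(i) of line `birth` v8 with its three Greenberg antecedents REMOVED:** on the Leopoldt cell, for every `Sf′` = the places of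
`K` over `N` prime to `3`, `corank_{ℤ_3}(Sel_{𝔭′}^{Sf′}(K_∞, E[3^∞]) / Sel_{𝔭′}^∅(K_∞, E[3^∞])) = Σ_{w∈Sf′} [Γ:Γ_w] · corank_{ℤ_3} H¹(ker κ ⊓ D_w, E[3^∞])`,
granted CGLS 2022 Prop. 14 by name ONLY (`X_{∅,0}(𝔭′)` f.g. torsion through B1; the surjectivity of §1; the count of p707562).
CONDITIONAL on that one named fact; closes nothing by itself.
[cite: PollackWeston2011, App. A Prop. A.2] [cite: GreenbergVatsal2000, §2 Cor. (2.3), Prop. (2.4)]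
[cite: CastellaGrossiLeeSkinner2022, §1.2 Prop. 14 and §1.4 (eq:1)] [cite: Brink2007, Thm. 2] -/
theorem stub_curveRelaxationCorankEq_ofPrint :
    Literature.NumberTheory.EllipticCurves.CastellaGrossiLeeSkinner2022.prop14_residualCharacterSelmer_finite →
    ∀ (W : WeierstrassCurve ℚ) [W.IsElliptic] [W.IsGloballyMinimal] (N : ℕ) [NeZero N] (K : Type) [Field K] [NumberField K], Summit.BirchSwinnertonDyer.Rank1Residual.Additive.ClassO6 W 3 → Literature.NumberTheory.EllipticCurves.Rank1Residual.Red W 3 → (∃ Φ : AddSubgroup (WeierstrassCurve.geomTorsion W ((3 : ℕ) : ℤ)), Literature.NumberTheory.EllipticCurves.Rank1Residual.IsRationalLine W 3 Φ ∧ ∀ (v : IsDedekindDomain.HeightOneSpectrum (NumberField.RingOfIntegers ℚ)), ((3 : ℕ) : NumberField.RingOfIntegers ℚ) ∈ v.asIdeal → ∀ 𝔓 ∈ v.primesAbove, ¬ (∀ g ∈ 𝔓.decompositionSubgroup (Field.absoluteGaloisGroup ℚ), ∀ P ∈ Φ, g • P = P) ∧ ¬ (∀ g ∈ 𝔓.decompositionSubgroup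 (Field.absoluteGaloisGroup ℚ), ∀ P : WeierstrassCurve.geomTorsion W ((3 : ℕ) : ℤ), g • P - P ∈ Φ)) → W.conductorNorm ℤ = N → Literature.NumberTheory.EllipticCurves.IsImaginaryQuadratic K → Literature.NumberTheory.EllipticCurves.SatisfiesHeegnerHypothesis N K → Odd (NumberField.discr K) → (∀ Q : (W.baseChange K).toAffine.Point, (3 : ℕ) • Q = 0 → Q = 0) → ∀ (κ : Literature.NumberTheory.EllipticCurves.ZpExtension K 3), κ.IsAnticyclotomic → ∀ (γ : Field.absoluteGaloisGroup K) [Fact (κ.IsTopGenerator γ)] (𝔭 : IsDedekindDomain.HeightOneSpectrum (NumberField.RingOfIntegers K)), ((3 : ℕ) : NumberField.RingOfIntegers K) ∈ 𝔭.asIdeal → 𝔭.asIdeal.ramificationIdx (NumberField.RingOfIntegers ℚ) = 1 → 𝔭.asIdeal.inertiaDeg (NumberField.RingOfIntegers ℚ) = 1 → ∀ (𝔭' : IsDedekindDomain.HeightOneSpectrum (NumberField.RingOfIntegers K)), ((3 : ℕ) : NumberField.RingOfIntegers K) ∈ 𝔭'.asIdeal → 𝔭' ≠ 𝔭 → ∀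 (Sf' : Finset (IsDedekindDomain.HeightOneSpectrum (NumberField.RingOfIntegers K))), (∀ w : IsDedekindDomain.HeightOneSpectrum (NumberField.RingOfIntegers K), w ∈ Sf' ↔ (((W.conductorNorm ℤ : ℤ) : NumberField.RingOfIntegers K) ∈ w.asIdeal ∧ ((3 : ℕ) : NumberField.RingOfIntegers K) ∉ w.asIdeal)) → Literature.NumberTheory.EllipticCurves.zpCorank (↥(Summit.BirchSwinnertonDyer.Rank1Residual.X11b.AcSelmer.selmerAc (W.baseChange K) 3 κ 𝔭' (↑Sf' : Set (IsDedekindDomain.HeightOneSpectrum (NumberField.RingOfIntegers K)))) ⧸ (Summit.BirchSwinnertonDyer.Rank1Residual.X11b.AcSelmer.selmerAc (W.baseChange K) 3 κ 𝔭' (∅ : Set (IsDedekindDomain.HeightOneSpectrum (NumberField.RingOfIntegers K)))).addSubgroupOf (Summit.BirchSwinnertonDyer.Rank1Residual.X11b.AcSelmer.selmerAc (W.baseChange K) 3 κ 𝔭' (↑Sf' : Set (IsDedekindDomain.HeightOneSpectrum (NumberField.RingOfIntegers K))))) 3 = ∑ w ∈ Sf', Literature.NumberTheory.EllipticCurves.KellerYin2024.numPlacesAbove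 κ w * Literature.NumberTheory.EllipticCurves.zpCorank (Literature.NumberTheory.EllipticCurves.subgroupH1 (κ.kerSubgroup ⊓ Literature.NumberTheory.EllipticCurves.GreenbergSelmer.decomp w) ((W.baseChange K).geomPrimaryTorsion 3)) 3 := by
  intro hP W _ _ N _ K _ _ hO6 hRed hcell hN hK hHN hodd hEK κ hκ γ hγI 𝔭 h𝔭 he hf 𝔭' h𝔭' hne Sf' hSf'
  haveI : Fact (Nat.Prime 3) := ⟨Nat.prime_three⟩
  haveI hEKi : (W.baseChange K).IsElliptic := inferInstanceAs (W.map (algebraMap ℚ K)).IsElliptic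
  -- `X_{∅,0}(𝔭′)` is finitely generated `Λ`-torsion, from print (CGLS Prop. 14 ⟹ B1 ⟹ Greenberg's criterion)
  have hfin := CumulativeHeegnerInclusionAtThreeB1OfPrint.stub_residualSelmerFinite_of_print hP
    CumulativeHeegnerInclusionAtThreeLineDet.stub_lineDeterminantAtThree
    CumulativeHeegnerInclusionAtThreeBadPlaces.stub_badPlacesSplitFinite W N K hO6 hRed hcell hN hK hHN κ hκ 𝔭' h𝔭'
  obtain ⟨hT, -⟩ :=
    EisensteinCharacterInvariantsAtThreeAlgebraicHalf.isTorsion_and_muInvariant_eq_zero_of_residualFinite W K κ γ 𝔭' hfin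
  have hXfin := Summit.BirchSwinnertonDyer.Rank1Residual.X11b.AcSelmer.XAc.module_finite κ 𝔭'
    (∅ : Set (HeightOneSpectrum (𝓞 K))) γ Set.finite_empty (W := W.baseChange K)
  subst hN
  -- the `K_∞`-side surjectivity at the tame bad places, no named fact (§1)
  obtain ⟨a, hdiv, hd₀, hsurj⟩ := curve_exists_forall_resOfLe_conjH1_pow_eq_tame_ofTree W (by norm_num) hK hHN h𝔭 h𝔭' hne κ hκ
    γ Sf' hSf' hXfin hT
  -- finite decomposition at `Sf′` (Brink, under (Heeg)) and the count
  have hSfdec : ∀ w ∈ Sf', ∃ δ ∈ decomp (K := K) w, κ δ ≠ 1 := fun w hw ↦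
    UnrSelmerQuotientTorsionFiniteChar.exists_mem_decomp_apply_ne_one_of_heegner hK (by norm_num) hHN κ hκ w
      ((hSf' w).mp hw).1 ((hSf' w).mp hw).2
  exact CurveRelaxationCount.zpCorank_selmerAc_quotient_eq_sum_of_forall_exists κ (W.baseChange K) 𝔭' Sf' hγI.out
    (fun w hw ↦ ((hSf' w).mp hw).2) hSfdec a hdiv hd₀ (fun _ i ↦ γ ^ i)
    (fun _ _ i _ ↦ UnrSelmerNaturalLocalization.toAdd_apply_pow_of_isTopGenerator κ hγI.out i) hsurj

end Summit.BirchSwinnertonDyer.BirchSwinnertonDyer.Theorems.EisensteinCharacterInvariantsAtThreeCurveRelaxationOfTree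

end
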